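import Mathlib
import Summits.Ventures.PercRepro2.TypedUntouched

/-!
# The gluing model of the star of `o` (blind cell PercRepro2, mine-2 g39, 2026-08-28;
`proofs/MINE2-GLUE.md` §1, row M2-83)

The finite model behind the GLUING LEMMA for a star gadget at the pole `o` whose edges all lead
to the marks `a₁, a₂, b`: a copy's state `(q′, L_o, H_o, L_b, H_b, L₃, H₃)` is the gluing
`S P N` of the rest's connection pattern `P` on the four marks `a₁, a₂, a₃, b` (six bits, a set
partition when it comes from a configuration) and the open-neighbour set `N = (o–a₁, o–a₂, o–b)`
of `o`: two marks are joined iff they are joined in the rest or both reach an open neighbour of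
`o`, and `o` is joined to a mark iff that mark reaches an open neighbour.  `PSYM N₁ N₂ N₃ P₁ P₂ P₃`
is the tree's kernel `KB` on the glued states, symmetrised over the three patterns (the
`symB`-symmetrisation of `TypedSepThreeSym.lean` with the star as the `A`-side), and
`C t₁ t₂ t_b P₁ P₂ P₃` the GADGET SUM: `PSYM` summed over the placements of the three star edges
with `t_v` open copies each (`plc`; `t = 0` absent or pinned closed, `t = 3` pinned open).
The certificate files `OStarCert0 … OStarCert3` decide `0 ≤ C` on every typing and every sorted
triple of `Q`-patterns; this file has the bookkeeping: `C` is symmetric in the patterns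
(`C_swap12`, `C_swap23`), vanishes when a pattern joins the roots (`C_eq_zero_of_p12`), and the
three-copy placement sums of `TypedSplit.lean` are the `plc` sums (`sum_bool3_eq_plc`).
Own code; standard axioms.
-/

namespace Summit.Ventures.PercRepro2

namespace CovForm

namespace OStar

open OneTyped Untouched

/-! ## Patterns, neighbour sets, glued states -/

/-- A connection pattern on the four marks `a₁, a₂, a₃, b`: the six bits
`(a₁a₂, a₁a₃, a₁b, a₂a₃, a₂b, a₃b)`. -/
abbrev Pat := Bool × Bool × Bool × Bool × Bool × Bool

/-- The open-neighbour set of `o`: `(o–a₁, o–a₂, o–b)`. -/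
abbrev Nb := Bool × Bool × Bool

/-- The connection bit of a pattern between two marks (`0 = a₁, 1 = a₂, 2 = a₃, 3 = b`). -/
def connP (P : Pat) : Fin 4 → Fin 4 → Bool
  | 0, 0 => true
  | 0, 1 => P.1
  | 0, 2 => P.2.1
  | 0, 3 => P.2.2.1
  | 1, 0 => P.1
  | 1, 1 => true
  | 1, 2 => P.2.2.2.1
  | 1, 3 => P.2.2.2.2.1
  | 2, 0 => P.2.1
  | 2, 1 => P.2.2.2.1
  | 2, 2 => true
  | 2, 3 => P.2.2.2.2.2
  | 3, 0 => P.2.2.1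
  | 3, 1 => P.2.2.2.2.1
  | 3, 2 => P.2.2.2.2.2
  | 3, 3 => true

/-- A mark reaches an open neighbour of `o` through the pattern. -/
def reach (P : Pat) (N : Nb) (u : Fin 4) : Bool :=
  (N.1 && connP P u 0) || (N.2.1 && connP P u 1) || (N.2.2 && connP P u 3)

/-- The glued connection between two marks: joined in the rest, or both reaching an open
neighbour of `o`. -/
def connG (P : Pat) (N : Nb) (u v : Fin 4) : Bool :=
  connP P u v || (reach P N u && reach P N v)

/-- The glued state `(q′, L_o, H_o, L_b, H_b, L₃, H₃)`. -/
def S (P : Pat) (N : Nb) : St :=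
  (connG P N 1 0, reach P N 0, reach P N 1, connG P N 0 3, connG P N 1 3, connG P N 0 2,
    connG P N 1 2)

/-- The kernel on the glued states, symmetrised over the three patterns (the neighbour sets
fixed). -/
def PSYM (N₁ N₂ N₃ : Nb) (P₁ P₂ P₃ : Pat) : ℤ :=
  KB (S P₁ N₁) (S P₂ N₂) (S P₃ N₃) + KB (S P₁ N₁) (S P₃ N₂) (S P₂ N₃) +
    KB (S P₂ N₁) (S P₁ N₂) (S P₃ N₃) + KB (S P₂ N₁) (S P₃ N₂) (S P₁ N₃) +
    KB (S P₃ N₁) (S P₁ N₂) (S P₂ N₃) + KB (S P₃ N₁) (S P₂ N₂) (S P₁ N₃)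

/-- The placements of one edge of type `t`: the triples of copy bits with `t` open copies. -/
def plc : ℕ → List (Bool × Bool × Bool)
  | 0 => [(false, false, false)]
  | 1 => [(true, false, false), (false, true, false), (false, false, true)]
  | 2 => [(true, true, false), (true, false, true), (false, true, true)]
  | 3 => [(true, true, true)]
  | _ => []

/-- The gadget sum of the typing `(t₁, t₂, t_b)` on a pattern triple: `PSYM` summed over the
placements of the three star edges. -/
def C (t₁ t₂ tb : ℕ) (P₁ P₂ P₃ : Pat) : ℤ :=
  ((plc t₁).map fun c₁ => ((plc t₂).map fun c₂ => ((plc tb).map fun cb =>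
    PSYM (c₁.1, c₂.1, cb.1) (c₁.2.1, c₂.2.1, cb.2.1) (c₁.2.2, c₂.2.2, cb.2.2) P₁ P₂ P₃).sum).sum).sum

/-- Transitivity on one triangle of marks. -/
def tri (a b c : Bool) : Bool := (!(a && b) || c) && (!(a && c) || b) && (!(b && c) || a)

/-- A pattern is a set partition of the four marks (the four triangles are transitive). -/
def valid (P : Pat) : Bool :=
  tri P.1 P.2.1 P.2.2.2.1 && tri P.1 P.2.2.1 P.2.2.2.2.1 && tri P.2.1 P.2.2.1 P.2.2.2.2.2 &&
    tri P.2.2.2.1 P.2.2.2.2.1 P.2.2.2.2.2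

/-- A `Q`-pattern: a set partition not joining the roots. -/
def validQ (P : Pat) : Bool := valid P && !P.1

/-- A numeric key for sorting patterns. -/
def key (P : Pat) : ℕ :=
  P.1.toNat + 2 * P.2.1.toNat + 4 * P.2.2.1.toNat + 8 * P.2.2.2.1.toNat + 16 * P.2.2.2.2.1.toNat +
    32 * P.2.2.2.2.2.toNat

/-! ## Symmetry of the gadget sum in the patterns -/

/-- `PSYM` is symmetric in its first two patterns. -/
lemma PSYM_swap12 (N₁ N₂ N₃ : Nb) (P₁ P₂ P₃ : Pat) :
    PSYM N₁ N₂ N₃ P₂ P₁ P₃ = PSYM N₁ N₂ N₃ P₁ P₂ P₃ := by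
  unfold PSYM; ring

/-- `PSYM` is symmetric in its last two patterns. -/
lemma PSYM_swap23 (N₁ N₂ N₃ : Nb) (P₁ P₂ P₃ : Pat) :
    PSYM N₁ N₂ N₃ P₁ P₃ P₂ = PSYM N₁ N₂ N₃ P₁ P₂ P₃ := by
  unfold PSYM; ring

/-- The gadget sum is symmetric in its first two patterns. -/
lemma C_swap12 (t₁ t₂ tb : ℕ) (P₁ P₂ P₃ : Pat) : C t₁ t₂ tb P₂ P₁ P₃ = C t₁ t₂ tb P₁ P₂ P₃ := by
  unfold C; simp only [PSYM_swap12]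

/-- The gadget sum is symmetric in its last two patterns. -/
lemma C_swap23 (t₁ t₂ tb : ℕ) (P₁ P₂ P₃ : Pat) : C t₁ t₂ tb P₁ P₃ P₂ = C t₁ t₂ tb P₁ P₂ P₃ := by
  unfold C; simp only [PSYM_swap23]

/-- Any permutation of the patterns, from the two swaps. -/
lemma C_perm (t₁ t₂ tb : ℕ) (P₁ P₂ P₃ : Pat) :
    C t₁ t₂ tb P₁ P₂ P₃ = C t₁ t₂ tb P₂ P₁ P₃ ∧ C t₁ t₂ tb P₁ P₂ P₃ = C t₁ t₂ tb P₁ P₃ P₂ ∧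
      C t₁ t₂ tb P₁ P₂ P₃ = C t₁ t₂ tb P₂ P₃ P₁ ∧ C t₁ t₂ tb P₁ P₂ P₃ = C t₁ t₂ tb P₃ P₁ P₂ ∧
      C t₁ t₂ tb P₁ P₂ P₃ = C t₁ t₂ tb P₃ P₂ P₁ := by
  refine ⟨(C_swap12 ..).symm, (C_swap23 ..).symm, ?_, ?_, ?_⟩
  · rw [C_swap23 t₁ t₂ tb P₂ P₁ P₃, C_swap12 t₁ t₂ tb P₁ P₂ P₃]
  · rw [← C_swap12 t₁ t₂ tb P₃ P₁ P₂, C_swap23 t₁ t₂ tb P₁ P₂ P₃]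
  · rw [← C_swap12 t₁ t₂ tb P₃ P₂ P₁, C_swap23 t₁ t₂ tb P₂ P₁ P₃, C_swap12 t₁ t₂ tb P₁ P₂ P₃]

/-! ## A pattern joining the roots contributes nothing -/

/-- The glued state of a pattern joining the roots fails `Q`. -/
lemma S_q'_of_p12 {P : Pat} (h : P.1 = true) (N : Nb) : (S P N).q' = true := by
  simp [S, St.q', connG, connP, h]

/-- `PSYM` vanishes when one of the patterns joins the roots. -/
lemma PSYM_eq_zero_of_p12 (N₁ N₂ N₃ : Nb) {P₁ P₂ P₃ : Pat}
    (h : P₁.1 = true ∨ P₂.1 = true ∨ P₃.1 = true) : PSYM N₁ N₂ N₃ P₁ P₂ P₃ = 0 := by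
  unfold PSYM
  rcases h with h | h | h
  · rw [KB_eq_zero_of_q' _ _ _ (Or.inl (S_q'_of_p12 h N₁)),
      KB_eq_zero_of_q' _ _ _ (Or.inl (S_q'_of_p12 h N₁)),
      KB_eq_zero_of_q' _ _ _ (Or.inr (Or.inl (S_q'_of_p12 h N₂))),
      KB_eq_zero_of_q' _ _ _ (Or.inr (Or.inr (S_q'_of_p12 h N₃))),
      KB_eq_zero_of_q' _ _ _ (Or.inr (Or.inl (S_q'_of_p12 h N₂))),
      KB_eq_zero_of_q' _ _ _ (Or.inr (Or.inr (S_q'_of_p12 h N₃)))]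
    ring
  · rw [KB_eq_zero_of_q' _ _ _ (Or.inr (Or.inl (S_q'_of_p12 h N₂))),
      KB_eq_zero_of_q' _ _ _ (Or.inr (Or.inr (S_q'_of_p12 h N₃))),
      KB_eq_zero_of_q' _ _ _ (Or.inl (S_q'_of_p12 h N₁)),
      KB_eq_zero_of_q' _ _ _ (Or.inl (S_q'_of_p12 h N₁)),
      KB_eq_zero_of_q' _ _ _ (Or.inr (Or.inr (S_q'_of_p12 h N₃))),
      KB_eq_zero_of_q' _ _ _ (Or.inr (Or.inl (S_q'_of_p12 h N₂)))]
    ring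
  · rw [KB_eq_zero_of_q' _ _ _ (Or.inr (Or.inr (S_q'_of_p12 h N₃))),
      KB_eq_zero_of_q' _ _ _ (Or.inr (Or.inl (S_q'_of_p12 h N₂))),
      KB_eq_zero_of_q' _ _ _ (Or.inr (Or.inr (S_q'_of_p12 h N₃))),
      KB_eq_zero_of_q' _ _ _ (Or.inr (Or.inl (S_q'_of_p12 h N₂))),
      KB_eq_zero_of_q' _ _ _ (Or.inl (S_q'_of_p12 h N₁)),
      KB_eq_zero_of_q' _ _ _ (Or.inl (S_q'_of_p12 h N₁))]
    ring

/-- The gadget sum vanishes when one of the patterns joins the roots. -/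
lemma C_eq_zero_of_p12 (t₁ t₂ tb : ℕ) {P₁ P₂ P₃ : Pat}
    (h : P₁.1 = true ∨ P₂.1 = true ∨ P₃.1 = true) : C t₁ t₂ tb P₁ P₂ P₃ = 0 := by
  unfold C
  simp only [PSYM_eq_zero_of_p12 _ _ _ h, List.map_const', List.sum_replicate, smul_zero]

/-! ## The three-copy placement sums are the `plc` sums -/

/-- The sum over the copy bits `(a, b, c)` with `a + b + c = t` is the sum over `plc t`. -/
lemma sum_bool3_eq_plc {R : Type*} [AddCommMonoid R] (t : ℕ) (f : Bool → Bool → Bool → R) :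
    (∑ a : Bool, ∑ b : Bool, ∑ c : Bool,
      if a.toNat + b.toNat + c.toNat = t then f a b c else 0) =
      ((plc t).map fun c => f c.1 c.2.1 c.2.2).sum := by
  rcases t with _ | _ | _ | _ | t
  · simp [plc]
  · simp [plc]
  · simp [plc]
    ac_rfl
  · simp [plc]
  · simp [plc]

end OStar

end CovForm

end Summit.Ventures.PercRepro2
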